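import Summits.RiemannHypothesis.RiemannHypothesis.Theorems.JensenPolynomialsSkeletonKTableL1
import Literature.Analysis.SpecialFunctions.LaguerreExtremeZeros

/-!
# Route `JensenPolynomials` — rung J-P (P1⁺): the K-TABLE FROM LEMMA L1 with the Ismail–Li zero bracket DISCHARGED

**RH-FREE, ξ-free** (arbitrary `γ` with `κ_n > 0`; `b = n + ½`, `c = bκ_n`, `s = √(d(b+d−2))`). The tree's K-table
`kTable_of_interlacingRatio` (this directory, `…SkeletonKTableL1`, eng-3 g3) carries as an explicit ANTECEDENT the zero bracket of
Ismail–Li for `L_{d−1}^{(n−½)}`: every zero `τ` lies in the oscillatory window `(τ − (b+2d−4))² ≤ 4d(b+d−2)` and has `|τ| ≤ T`.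
Since 2026-08-26 the bracket is a tree theorem (`Literature/Analysis/SpecialFunctions/LaguerreExtremeZeros.lean`, cell rh-columns-lit:
`le_ismailLi_of_isRoot_laguerre` = Ismail–Li 1992 Thm. 4 / Ismail 2005 (7.2.9), `sq_sub_le_of_isRoot_laguerre`, with
`pos_of_isRoot_laguerre`), so the antecedent can be removed:

* `laguerre_zero_bracket_ismailLi` — for every `d ≥ 2` and every zero `τ` of `L_{d−1}^{(n−½)}`: the window, and
  `|τ| ≤ T(d,n) := 2d + b − 5 + √(1 + 4(d−2)(d+b−3))` (the `a = 4cos²(π/d)` size bound weakened to `a = 4`; at `d = 2`, `T = b` is the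
  single zero of `L₁^{(b−1)}`) — the snippet `pub/rh-columns/snippets/KTableHzero.lean` of rh-columns-lit g5, verbatim;
* `kTable_of_interlacingRatio_ismailLi` — **the K-table with NO zero hypothesis**: for `3 ≤ m ≤ d`, every L1-majorant `M ≥ 0`,
  at every critical point `e` of the skeleton `A^d_{s_n}`:
  `|A^{d−m}_{s_n}(e)| ≤ K_m·|A^d_{s_n}(e)|`, `K_m = ((d−m)!/d!)·(T(d,n)/c)^m·(b+d−1)·d·s^{m−2}·M_{m−2}`.

So the K-side of the skeleton sign test (`skeletonSignTest_of_tables` / `skeletonSignTestLaw_xi_of_named_tables`) is now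
«a majorant `M` + arithmetic» — the only remaining inputs of a skeleton law are the E-side analytic bounds on `skelQuotSeq`
(TABLE Z / LEMMA Z′ of the CAL write-up of THEOREM α) and the finite evaluation `Σ E_m K_m < 1`.
WHAT THIS IS NOT: no cell of the test and no bound on ξ's coefficients is proved; nothing here bears on the truth of RH.

References: [IsmailLi1992] M. E. H. Ismail, X. Li, Proc. AMS 115 (1992), Thm. 4; [Ismail2005] M. E. H. Ismail, *Classical and Quantum
Orthogonal Polynomials in One Variable*, Thm. 7.2.8 (7.2.9)–(7.2.10); [Szego1975] G. Szegő, *Orthogonal Polynomials*, (5.1.14).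
-/

noncomputable section
-- D-0017: `Summit.RiemannHypothesis.RiemannHypothesis.…` duplicates the namespace BY DESIGN (single-problem summit).
set_option linter.dupNamespace false

namespace Summit.RiemannHypothesis.RiemannHypothesis.Theorems.JensenPolynomials

open Literature.NumberTheory.LFunctions Polynomial Finset
open Literature.Analysis.SpecialFunctions (laguerre le_ismailLi_of_isRoot_laguerre sq_sub_le_of_isRoot_laguerre
  pos_of_isRoot_laguerre)
open scoped BigOperators Nat

/-- **The Ismail–Li zero bracket in the K-table's shape (RH-FREE, ξ-free).** For `d ≥ 2` and every zero `τ` of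
`L_{d−1}^{(n−½)}` (`b = n + ½`): the oscillatory window `(τ − (b+2d−4))² ≤ 4d(b+d−2)` and the size bound
`|τ| ≤ 2d + b − 5 + √(1 + 4(d−2)(d+b−3))` (Ismail–Li's `4cos²(π/d)` weakened to `4`; `τ > 0`). -/
theorem laguerre_zero_bracket_ismailLi (n d : ℕ) (hd : 2 ≤ d) (τ : ℝ)
    (hτ : (laguerre ((n : ℝ) - 1 / 2) (d - 1)).eval τ = 0) :
    (τ - ((n : ℝ) + 1 / 2 + 2 * d - 4)) ^ 2 ≤ 4 * (d * ((n : ℝ) + 1 / 2 + d - 2)) ∧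
    |τ| ≤ 2 * d + ((n : ℝ) + 1 / 2) - 5 +
      Real.sqrt (1 + 4 * ((d : ℝ) - 2) * ((d : ℝ) + ((n : ℝ) + 1 / 2) - 3)) := by
  have hn0 : (0 : ℝ) ≤ n := Nat.cast_nonneg n
  have hα : (-1 : ℝ) < (n : ℝ) - 1 / 2 := by linarith
  have hx : (laguerre ((n : ℝ) - 1 / 2) (d - 1)).IsRoot τ := hτ
  have hN : 1 ≤ d - 1 := by omega
  have hd2 : (2 : ℝ) ≤ d := by exact_mod_cast hd
  have hcast : ((d - 1 : ℕ) : ℝ) = (d : ℝ) - 1 := by rw [Nat.cast_sub (by omega), Nat.cast_one]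
  constructor
  · have h := sq_sub_le_of_isRoot_laguerre hα hx
    rw [hcast] at h
    calc (τ - ((n : ℝ) + 1 / 2 + 2 * d - 4)) ^ 2
        = (τ - (2 * ((d : ℝ) - 1) + ((n : ℝ) - 1 / 2) - 1)) ^ 2 := by ring
      _ ≤ 4 * (((d : ℝ) - 1 + 1) * ((d : ℝ) - 1 + ((n : ℝ) - 1 / 2))) := h
      _ = 4 * (d * ((n : ℝ) + 1 / 2 + d - 2)) := by ring
  · have h := le_ismailLi_of_isRoot_laguerre hα hN hx
    rw [hcast] at h
    rw [abs_of_pos (pos_of_isRoot_laguerre hα hx)]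
    -- weaken `4cos²(π/d)` to `4` inside the square root
    have hP : 0 ≤ ((d : ℝ) - 1 - 1) * ((d : ℝ) - 1 + ((n : ℝ) - 1 / 2) - 1) := by
      rcases eq_or_lt_of_le hd with h2 | h3
      · rw [← h2]; norm_num
      · have hd3 : (3 : ℝ) ≤ d := by exact_mod_cast h3
        exact mul_nonneg (by linarith) (by linarith)
    have hcos : Real.cos (Real.pi / ((d : ℝ) - 1 + 1)) ^ 2 ≤ 1 := by
      rw [sq_le_one_iff_abs_le_one]; exact Real.abs_cos_le_one _
    have hmono : Real.sqrt (1 + 4 * Real.cos (Real.pi / ((d : ℝ) - 1 + 1)) ^ 2 * ((d : ℝ) - 1 - 1) *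
          ((d : ℝ) - 1 + ((n : ℝ) - 1 / 2) - 1)) ≤
        Real.sqrt (1 + 4 * ((d : ℝ) - 2) * ((d : ℝ) + ((n : ℝ) + 1 / 2) - 3)) := by
      apply Real.sqrt_le_sqrt
      have e : ((d : ℝ) - 2) * ((d : ℝ) + ((n : ℝ) + 1 / 2) - 3) =
          ((d : ℝ) - 1 - 1) * ((d : ℝ) - 1 + ((n : ℝ) - 1 / 2) - 1) := by ring
      rw [mul_assoc (4 : ℝ) ((d : ℝ) - 2), e]
      nlinarith [mul_le_mul_of_nonneg_right hcos hP]
    linarith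

/-- **K-table from LEMMA L1, zero bracket DISCHARGED (RH-FREE, ξ-free).** Let `κ_n > 0`, `2 ≤ d`, `3 ≤ m ≤ d`, `b = n + ½`,
`c = bκ_n`, `s = √(d(b+d−2))`, `T = 2d + b − 5 + √(1 + 4(d−2)(d+b−3))`; let `M ≥ 0` be an L1-majorant (`hM`). Then at every critical
point `e` of the skeleton `A^d_{s_n}`: `|A^{d−m}_{s_n}(e)| ≤ K_m·|A^d_{s_n}(e)|` with `K_m = ((d−m)!/d!)·(T/c)^m·(b+d−1)·d·s^{m−2}·M_{m−2}`
— `kTable_of_interlacingRatio` with its `hzero` supplied by `laguerre_zero_bracket_ismailLi`. -/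
theorem kTable_of_interlacingRatio_ismailLi (γ : ℕ → ℝ) (n d m : ℕ) (hd : 2 ≤ d) (hm3 : 3 ≤ m) (hmd : m ≤ d)
    (hκ : 0 < skelKappa γ n) {M : ℕ → ℝ}
    (hM : ∀ k : ℕ, k ≤ d - 2 →
      (k + 1 : ℝ) + ∑ j ∈ Ico 1 k, ((k : ℝ) - j) *
        (j * (2 / Real.sqrt (d * ((n : ℝ) + 1 / 2 + d - 2))) * M j +
          ((j + 1) / d + j / ((n : ℝ) + 1 / 2 + d - 2)) * M (j - 1)) ≤ M k)
    (hM0 : ∀ k : ℕ, k ≤ d - 2 → 0 ≤ M k) :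
    ∀ e : ℝ, (derivative (appellPoly (skeletonSeq γ n) d)).eval e = 0 →
      |(appellPoly (skeletonSeq γ n) (d - m)).eval e| ≤
        ((((d - m) ! : ℕ) : ℝ) / (d ! : ℝ) *
          ((2 * d + ((n : ℝ) + 1 / 2) - 5 +
              Real.sqrt (1 + 4 * ((d : ℝ) - 2) * ((d : ℝ) + ((n : ℝ) + 1 / 2) - 3))) /
            (((n : ℝ) + 1 / 2) * skelKappa γ n)) ^ m *
          ((n : ℝ) + 1 / 2 + d - 1) * d * Real.sqrt (d * ((n : ℝ) + 1 / 2 + d - 2)) ^ (m - 2) * M (m - 2)) *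
        |(appellPoly (skeletonSeq γ n) d).eval e| :=
  kTable_of_interlacingRatio γ n d m hd hm3 hmd hκ hM hM0
    (fun τ hτ => laguerre_zero_bracket_ismailLi n d hd τ hτ)

/-- **Size of the explicit `T`:** `0 ≤ T(d,n)` and `T(d,n) ≤ 4d + 2n − 7` for `d ≥ 2` (AM–GM on the square root; handy for
crude bookkeeping — the K-table itself should be used with the exact `T`). -/
theorem ismailLiT_nonneg_le (n d : ℕ) (hd : 2 ≤ d) :
    0 ≤ 2 * d + ((n : ℝ) + 1 / 2) - 5 + Real.sqrt (1 + 4 * ((d : ℝ) - 2) * ((d : ℝ) + ((n : ℝ) + 1 / 2) - 3)) ∧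
    2 * d + ((n : ℝ) + 1 / 2) - 5 + Real.sqrt (1 + 4 * ((d : ℝ) - 2) * ((d : ℝ) + ((n : ℝ) + 1 / 2) - 3)) ≤
      4 * d + 2 * n - 7 := by
  have hn0 : (0 : ℝ) ≤ n := Nat.cast_nonneg n
  have hd2 : (2 : ℝ) ≤ d := by exact_mod_cast hd
  have hsq1 : 1 ≤ Real.sqrt (1 + 4 * ((d : ℝ) - 2) * ((d : ℝ) + ((n : ℝ) + 1 / 2) - 3)) := by
    rw [show (1 : ℝ) = Real.sqrt 1 from Real.sqrt_one.symm]
    apply Real.sqrt_le_sqrt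
    rcases eq_or_lt_of_le hd with h2 | h3
    · rw [← h2]; norm_num
    · have hd3 : (3 : ℝ) ≤ d := by exact_mod_cast h3
      nlinarith [mul_nonneg (by linarith : (0 : ℝ) ≤ (d : ℝ) - 2) (by linarith : (0 : ℝ) ≤ (d : ℝ) + ((n : ℝ) + 1 / 2) - 3)]
  constructor
  · linarith
  · -- `√(1 + 4xy) ≤ 1 + x + y` for `x = d − 2 ≥ 0`, `y = d + b − 3` (if `y < 0` then `d = 2` and the root is `1`)
    rcases eq_or_lt_of_le hd with h2 | h3
    · rw [← h2]; norm_num; linarith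
    · have hd3 : (3 : ℝ) ≤ d := by exact_mod_cast h3
      have hx : 0 ≤ (d : ℝ) - 2 := by linarith
      have hy : 0 ≤ (d : ℝ) + ((n : ℝ) + 1 / 2) - 3 := by linarith
      have hroot : Real.sqrt (1 + 4 * ((d : ℝ) - 2) * ((d : ℝ) + ((n : ℝ) + 1 / 2) - 3)) ≤
          1 + ((d : ℝ) - 2) + ((d : ℝ) + ((n : ℝ) + 1 / 2) - 3) := by
        rw [Real.sqrt_le_left (by linarith)]
        nlinarith [sq_nonneg (((d : ℝ) - 2) - ((d : ℝ) + ((n : ℝ) + 1 / 2) - 3)), mul_nonneg hx hy]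
      linarith

end Summit.RiemannHypothesis.RiemannHypothesis.Theorems.JensenPolynomials

end
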